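import Summits.SmoothPoincare4.SmoothPoincare4.Theorems.CylinderEntropyImmortalAreaToFloorWeightedMonotonicity
import Summits.SmoothPoincare4.SmoothPoincare4.Theorems.CylinderEntropyImmortalAreaToFloorGaussianBounds
import Summits.SmoothPoincare4.SmoothPoincare4.Theorems.CylinderEntropyCylinderRungTwoProductTestLimitBounds
import HarnessLib

/-!
# Route `CylinderEntropy`, item `ImmortalAreaToFloor` (stmt-SmoothPoincare4-17197):
# pointwise devices for the height-cut piece and the cost of the cut at the starting scale (module Γ6b
# of `BLUEPRINT-17197-c2.md`, part 1)

For a closed immersed cross-section `f : M⁴ → N ⊂ ℝ⁶` with smooth unit normal `ν` tangent to `N`,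
mean curvature `H`, a centre `x₀ ∈ ℝ⁶`, a scale `s > 0`, a near-radius `ρ ≥ 0`, the Gaussian weight
`G_s = exp(-‖f - x₀‖²/(4s))/(4πs)²` and a height weight `u ∈ C²(ℝ)` with `|u'| ≤ c₁/g`,
`|u''| ≤ c₂/g²`, this file collects the pointwise devices of the cutoff-error estimates (`mul_exp_neg_sq_half_le`,
`mul_gaussian_le_gaussian_double`: the first moment of the Gaussian profile is a Gaussian at the
doubled scale; `abs_vertical_transport_le`: `|r₅ - ν₅⟨r,ν⟩| ≤ ‖r‖ |ν'|`; the AM–GM inequalities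
`two_mul_sqrt_le`, `two_mul_abs_le`) and proves
* `weightedDensity_initial_ge` — at the starting scale the cut costs only a Gaussian tail:
  `∫ G_σ - 4 e^{-g²/(72σ)} ∫ G_{2σ} ≤ ∫ u G_σ` if `u = 1` on heights within `g/3` of `x₀`
  (tails by scale doubling, landed `gaussian_tail_pointwise`).

References: W. K. Allard, Ann. of Math. 95 (1972) §6; K. Ecker, *Regularity Theory for Mean Curvature
Flow* (2004), proof of Prop. 3.17 (localised monotonicity, error terms of the cutoff).
-/

-- the prescribed namespace `Summit.SmoothPoincare4.SmoothPoincare4.…` repeats `SmoothPoincare4`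
set_option linter.dupNamespace false

noncomputable section

open Bundle Set Function Filter MeasureTheory Module
open scoped Manifold ContDiff Topology RealInnerProductSpace BigOperators

namespace Summit.SmoothPoincare4.SmoothPoincare4.Cruxes.CylinderRungTwo.KillingFlux

open Literature.Geometry.Riemannian Literature.Geometry.Riemannian.EuclideanHypersurface
open Literature.Geometry.Lorentzian Literature.Geometry.Lorentzian.PseudoRiemannianMetric
open Summit.SmoothPoincare4.SmoothPoincare4.Theorems.GaussianBounds

/-! ## Elementary pointwise facts -/

section Pointwise

/-- `y e^{-y²/2} ≤ e^{-1/2}` for every real `y` (`e^{(y²-1)/2} ≥ (1+y²)/2 ≥ y`). [folklore] -/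
theorem mul_exp_neg_sq_half_le (y : ℝ) : y * Real.exp (-y ^ 2 / 2) ≤ Real.exp (-(1 / 2)) := by
  have h1 : (y ^ 2 - 1) / 2 + 1 ≤ Real.exp ((y ^ 2 - 1) / 2) := Real.add_one_le_exp _
  have h2 : y ≤ (y ^ 2 - 1) / 2 + 1 := by nlinarith [sq_nonneg (y - 1)]
  have h3 : y ≤ Real.exp ((y ^ 2 - 1) / 2) := h2.trans h1
  have h4 : Real.exp ((y ^ 2 - 1) / 2) * Real.exp (-y ^ 2 / 2) = Real.exp (-(1 / 2)) := by
    rw [← Real.exp_add]; congr 1; ring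
  calc y * Real.exp (-y ^ 2 / 2) ≤ Real.exp ((y ^ 2 - 1) / 2) * Real.exp (-y ^ 2 / 2) :=
      mul_le_mul_of_nonneg_right h3 (Real.exp_pos _).le
    _ = Real.exp (-(1 / 2)) := h4

/-- **The first moment of the Gaussian profile is a Gaussian at the doubled scale**:
`t e^{-t²/(4s)}/(4πs)² ≤ 8 √s e^{-1/2} · e^{-t²/(4·2s)}/(4π·2s)²` for real `t`, `s > 0`. [folklore] -/
theorem mul_gaussian_le_gaussian_double (t : ℝ) {s : ℝ} (hs : 0 < s) :
    t * (Real.exp (-t ^ 2 / (4 * s)) / (4 * Real.pi * s) ^ 2) ≤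
      8 * Real.sqrt s * Real.exp (-(1 / 2)) * (Real.exp (-t ^ 2 / (4 * (2 * s))) / (4 * Real.pi * (2 * s)) ^ 2) := by
  have hπ := Real.pi_pos
  have hss : 0 < Real.sqrt s := Real.sqrt_pos.2 hs
  have hsq : Real.sqrt s ^ 2 = s := Real.sq_sqrt hs.le
  -- `t e^{-t²/(8s)} ≤ 2√s e^{-1/2}` with `y = t/(2√s)`
  set y := t / (2 * Real.sqrt s) with hy
  have hty : t = 2 * Real.sqrt s * y := by rw [hy]; field_simp
  have hkey := mul_exp_neg_sq_half_le y
  have hexp8 : Real.exp (-t ^ 2 / (8 * s)) = Real.exp (-y ^ 2 / 2) := by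
    congr 1; rw [hty, mul_pow, mul_pow, hsq]; field_simp; ring
  have hmom : t * Real.exp (-t ^ 2 / (8 * s)) ≤ 2 * Real.sqrt s * Real.exp (-(1 / 2)) := by
    rw [hexp8, hty, mul_assoc]
    exact mul_le_mul_of_nonneg_left hkey (by positivity)
  -- split `e^{-t²/(4s)} = e^{-t²/(8s)} e^{-t²/(8s)}`
  have hsplit : Real.exp (-t ^ 2 / (4 * s)) = Real.exp (-t ^ 2 / (8 * s)) * Real.exp (-t ^ 2 / (8 * s)) := by
    rw [← Real.exp_add]; congr 1; field_simp; ring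
  have h8 : Real.exp (-t ^ 2 / (4 * (2 * s))) = Real.exp (-t ^ 2 / (8 * s)) := by
    congr 1; ring
  have hL : t * (Real.exp (-t ^ 2 / (4 * s)) / (4 * Real.pi * s) ^ 2) =
      (t * Real.exp (-t ^ 2 / (8 * s))) * (Real.exp (-t ^ 2 / (8 * s)) / (4 * Real.pi * s) ^ 2) := by
    rw [hsplit]; ring
  have hR : 8 * Real.sqrt s * Real.exp (-(1 / 2)) *
      (Real.exp (-t ^ 2 / (4 * (2 * s))) / (4 * Real.pi * (2 * s)) ^ 2) =
      (2 * Real.sqrt s * Real.exp (-(1 / 2))) * (Real.exp (-t ^ 2 / (8 * s)) / (4 * Real.pi * s) ^ 2) := by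
    rw [h8]; field_simp; ring
  rw [hL, hR]
  exact mul_le_mul_of_nonneg_right hmom (by positivity)

/-- For a unit vector `ν ∈ ℝ⁶` and any `r ∈ ℝ⁶`: `|r₅ - ν₅ ⟨r, ν⟩| ≤ ‖r‖ √(∑_{i<5} νᵢ²)`
(`r₅ - ν₅⟨r,ν⟩ = ⟨r, e₅ - ν₅ ν⟩` and `‖e₅ - ν₅ ν‖² = 1 - ν₅² = |ν'|²`). [folklore] -/
theorem abs_vertical_transport_le {ν r : EuclideanSpace ℝ (Fin 6)} (hν : ‖ν‖ = 1) :
    |r 5 - ν 5 * ⟪r, ν⟫| ≤ ‖r‖ * Real.sqrt (∑ i : Fin 5, ν (Fin.castSucc i) ^ 2) := by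
  set e5 : EuclideanSpace ℝ (Fin 6) := EuclideanSpace.single (5 : Fin 6) (1 : ℝ) with he5
  have hr5 : r 5 = ⟪r, e5⟫ := by
    rw [he5, EuclideanSpace.inner_single_right]; simp
  have hid : r 5 - ν 5 * ⟪r, ν⟫ = ⟪r, e5 - ν 5 • ν⟫ := by
    rw [inner_sub_right, inner_smul_right, hr5]
  have hS := norm_sq_eq_sum_castSucc_add_sq ν
  rw [hν, one_pow] at hS
  have hnorm : ‖e5 - ν 5 • ν‖ ^ 2 = ∑ i : Fin 5, ν (Fin.castSucc i) ^ 2 := by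
    have he5n : ‖e5‖ = 1 := by rw [he5]; simp
    have hinner : ⟪e5, ν⟫ = ν 5 := by rw [he5, EuclideanSpace.inner_single_left]; simp
    rw [@norm_sub_sq_real, real_inner_smul_right, hinner, norm_smul, hν, mul_one, he5n,
      Real.norm_eq_abs, sq_abs, one_pow]
    linarith [hS]
  have hnn : ‖e5 - ν 5 • ν‖ = Real.sqrt (∑ i : Fin 5, ν (Fin.castSucc i) ^ 2) := by
    rw [← hnorm, Real.sqrt_sq (norm_nonneg _)]
  rw [hid, ← hnn]
  exact abs_real_inner_le_norm _ _

/-- `2 √S ≤ κ S + κ⁻¹` for `S ≥ 0`, `κ > 0`. [folklore] -/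
theorem two_mul_sqrt_le {S κ : ℝ} (hS : 0 ≤ S) (hκ : 0 < κ) : 2 * Real.sqrt S ≤ κ * S + κ⁻¹ := by
  have hs : Real.sqrt S ^ 2 = S := Real.sq_sqrt hS
  have hκ0 : κ ≠ 0 := hκ.ne'
  have h1 : κ * (κ * S + κ⁻¹ - 2 * Real.sqrt S) = (κ * Real.sqrt S - 1) ^ 2 := by
    have e1 : (κ * Real.sqrt S - 1) ^ 2 = κ ^ 2 * S - 2 * κ * Real.sqrt S + 1 := by
      rw [sub_sq, mul_pow, hs]; ring
    rw [e1]; field_simp; ring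
  have h2 : 0 ≤ κ * (κ * S + κ⁻¹ - 2 * Real.sqrt S) := by rw [h1]; exact sq_nonneg _
  have h3 := (mul_nonneg_iff_of_pos_left hκ).1 h2
  linarith

/-- `2 |H| ≤ λ H² + λ⁻¹` for `λ > 0`. [folklore] -/
theorem two_mul_abs_le {H lam : ℝ} (hl : 0 < lam) : 2 * |H| ≤ lam * H ^ 2 + lam⁻¹ := by
  have h := sq_nonneg (lam * |H| - 1)
  have hl0 : lam ≠ 0 := hl.ne'
  have : lam * (lam * H ^ 2 + lam⁻¹ - 2 * |H|) = (lam * |H| - 1) ^ 2 := by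
    field_simp
    rw [← sq_abs H]
    ring
  have h2 : 0 ≤ lam * (lam * H ^ 2 + lam⁻¹ - 2 * |H|) := by rw [this]; exact h
  have h3 := (mul_nonneg_iff_of_pos_left hl).1 h2
  linarith

end Pointwise

/-! ## The cost of the cut at the starting scale -/

section Initial

variable {M : Type*} [TopologicalSpace M] [ChartedSpace (EuclideanSpace ℝ (Fin 4)) M]
  [IsManifold (𝓡 4) ∞ M] [CompactSpace M] [T2Space M] [MeasurableSpace M] [BorelSpace M]

/-- **The cut costs only a Gaussian tail at the starting scale.**  If `0 ≤ u ≤ 1` and `u(t) = 1`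
whenever `|t - (x₀)₅| < g/3`, then for every `σ > 0`:
`∫ G_σ - 4 e^{-g²/(72σ)} ∫ G_{2σ} ≤ ∫ u(z₅) G_σ`
(`1 - u(f₅) ≤ 𝟙{‖f - x₀‖ ≥ g/3}` since `|f₅ - (x₀)₅| ≤ ‖f - x₀‖`, then `gaussian_tail_pointwise`).
[cite: Allard1972, §6] -/
theorem weightedDensity_initial_ge {f : M → EuclideanSpace ℝ (Fin 6)}
    (hf : (euclideanMetric (EuclideanSpace ℝ (Fin 6))).IsSpacelikeImmersion (𝓡 4) f)
    (x₀ : EuclideanSpace ℝ (Fin 6)) {σ g : ℝ} (hσ : 0 < σ) (hg : 0 < g)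
    {u : ℝ → ℝ} (huc : Continuous u) (hu01 : ∀ t, 0 ≤ u t ∧ u t ≤ 1)
    (hu1 : ∀ t, |t - x₀ 5| < g / 3 → u t = 1) :
    ∫ w, Real.exp (-‖f w - x₀‖ ^ 2 / (4 * σ)) / (4 * Real.pi * σ) ^ 2
        ∂riemannianMeasure ((euclideanMetric (EuclideanSpace ℝ (Fin 6))).inducedRiemannianMetric f
          contMDiff_pullbackBilin_holds hf)
      - 4 * Real.exp (-g ^ 2 / (72 * σ)) *
        ∫ w, Real.exp (-‖f w - x₀‖ ^ 2 / (4 * (2 * σ))) / (4 * Real.pi * (2 * σ)) ^ 2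
          ∂riemannianMeasure ((euclideanMetric (EuclideanSpace ℝ (Fin 6))).inducedRiemannianMetric f
            contMDiff_pullbackBilin_holds hf) ≤
      ∫ w, u (f w 5) * (Real.exp (-‖f w - x₀‖ ^ 2 / (4 * σ)) / (4 * Real.pi * σ) ^ 2)
        ∂riemannianMeasure ((euclideanMetric (EuclideanSpace ℝ (Fin 6))).inducedRiemannianMetric f
          contMDiff_pullbackBilin_holds hf) := by
  set g₁ := (euclideanMetric (EuclideanSpace ℝ (Fin 6))).inducedRiemannianMetric f
    contMDiff_pullbackBilin_holds hf with hg₁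
  set μ := riemannianMeasure g₁ with hμ
  set G : M → ℝ := fun w => Real.exp (-‖f w - x₀‖ ^ 2 / (4 * σ)) / (4 * Real.pi * σ) ^ 2 with hG
  set G2 : M → ℝ := fun w => Real.exp (-‖f w - x₀‖ ^ 2 / (4 * (2 * σ))) / (4 * Real.pi * (2 * σ)) ^ 2
    with hG2
  set N : Set M := f ⁻¹' Metric.ball x₀ (g / 3) with hN
  have hπ := Real.pi_pos
  have hfc : Continuous f := hf.contMDiff_self.continuous
  have hGc : Continuous G := continuous_gaussianWeight_comp hf x₀ σ
  have hG2c : Continuous G2 := continuous_gaussianWeight_comp hf x₀ (2 * σ)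
  have h5c : Continuous fun w => f w 5 :=
    (EuclideanSpace.proj (5 : Fin 6) : EuclideanSpace ℝ (Fin 6) →L[ℝ] ℝ).continuous.comp hfc
  have hNm : MeasurableSet N := (Metric.isOpen_ball.preimage hfc).measurableSet
  have hG0 : ∀ w, 0 ≤ G w := fun w => gaussianWeight_comp_nonneg f x₀ w
  have hGi : Integrable G μ := integrable_of_continuous (h := g₁) hGc
  have hG2i : Integrable G2 μ := integrable_of_continuous (h := g₁) hG2c
  have hUGi : Integrable (fun w => u (f w 5) * G w) μ :=
    integrable_of_continuous (h := g₁) ((huc.comp h5c).mul hGc)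
  have hDi : Integrable (fun w => (1 - u (f w 5)) * G w) μ :=
    integrable_of_continuous (h := g₁) ((continuous_const.sub (huc.comp h5c)).mul hGc)
  -- `∫ u G = ∫ G - ∫ (1-u) G`
  have hdec : ∫ w, u (f w 5) * G w ∂μ = ∫ w, G w ∂μ - ∫ w, (1 - u (f w 5)) * G w ∂μ := by
    rw [← integral_sub hGi hDi]
    refine integral_congr_ae (Eventually.of_forall fun w => ?_)
    ring
  -- `(1-u) G` vanishes on the near region and is `≤ G ≤ 4 e^{..} G₂` on the far region
  have hg3 : 0 ≤ g / 3 := by positivity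
  have hpt : ∀ w, (1 - u (f w 5)) * G w ≤ (Nᶜ).indicator (fun w => 4 * Real.exp (-g ^ 2 / (72 * σ)) * G2 w) w := by
    intro w
    by_cases hw : w ∈ N
    · -- near: `u = 1`
      have hnear : ‖f w - x₀‖ < g / 3 := by
        simpa only [hN, mem_preimage, Metric.mem_ball, dist_eq_norm] using hw
      have h5 : |f w 5 - x₀ 5| < g / 3 := by
        have hcomp : |(f w - x₀) 5| ≤ ‖f w - x₀‖ := by
          have h := norm_sq_eq_sum_castSucc_add_sq (f w - x₀)
          have hs0 : 0 ≤ ∑ i : Fin 5, (f w - x₀) (Fin.castSucc i) ^ 2 :=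
            Finset.sum_nonneg fun i _ => sq_nonneg _
          have hsq : ((f w - x₀) 5) ^ 2 ≤ ‖f w - x₀‖ ^ 2 := by linarith
          have := sq_le_sq.1 hsq
          rwa [abs_norm] at this
        have : (f w - x₀) 5 = f w 5 - x₀ 5 := rfl
        rw [this] at hcomp
        exact lt_of_le_of_lt hcomp hnear
      rw [hu1 _ h5, indicator_of_notMem (notMem_compl_iff.2 hw)]
      simp
    · -- far
      rw [indicator_of_mem (mem_compl hw)]
      have hρw : g / 3 ≤ ‖f w - x₀‖ := by
        simp only [hN, mem_preimage, Metric.mem_ball, dist_eq_norm, not_lt] at hw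
        exact hw
      have htail := gaussian_tail_pointwise hσ hg3 hρw
      have h72 : Real.exp (-(g / 3) ^ 2 / (8 * σ)) = Real.exp (-g ^ 2 / (72 * σ)) := by
        congr 1; ring
      rw [h72] at htail
      calc (1 - u (f w 5)) * G w ≤ 1 * G w :=
            mul_le_mul_of_nonneg_right (by linarith [(hu01 (f w 5)).1]) (hG0 w)
        _ = G w := one_mul _
        _ ≤ 4 * Real.exp (-g ^ 2 / (72 * σ)) * G2 w := htail
  have hfar_int : ∫ w, (1 - u (f w 5)) * G w ∂μ ≤ 4 * Real.exp (-g ^ 2 / (72 * σ)) * ∫ w, G2 w ∂μ := by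
    calc ∫ w, (1 - u (f w 5)) * G w ∂μ
        ≤ ∫ w, (Nᶜ).indicator (fun w => 4 * Real.exp (-g ^ 2 / (72 * σ)) * G2 w) w ∂μ :=
          integral_mono hDi ((hG2i.const_mul _).indicator hNm.compl) hpt
      _ = ∫ w in Nᶜ, 4 * Real.exp (-g ^ 2 / (72 * σ)) * G2 w ∂μ := integral_indicator hNm.compl
      _ ≤ ∫ w, 4 * Real.exp (-g ^ 2 / (72 * σ)) * G2 w ∂μ := by
          refine setIntegral_le_integral (hG2i.const_mul _) (Eventually.of_forall fun w => ?_)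
          exact mul_nonneg (by positivity) (gaussianWeight_comp_nonneg f x₀ w)
      _ = 4 * Real.exp (-g ^ 2 / (72 * σ)) * ∫ w, G2 w ∂μ := integral_const_mul _ _
  rw [hdec]
  linarith

end Initial

end Summit.SmoothPoincare4.SmoothPoincare4.Cruxes.CylinderRungTwo.KillingFlux

end
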